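import Mathlib
import Summits.ValiantsHypothesis.ValiantsHypothesis.Theorems.RigidityForcesSymmetryRankRigidMinimalReprLaplaceFiveSeparatedCaptureDefs

/-!
# ValiantsHypothesis / RigidityForcesSymmetry — crux `LaplaceOptimalFive` (stmt-ValiantsHypothesis-24813), crux idea
`separated-capture` (val-idea-19 g8) — part 2/3: OBLIGATIONS ARE CAPTURED, and `CaptureIneq` ⇒ THE CRUX ON SEPARATED PAIR PROFILES

PORT of the crux workfile `Cruxes/LaplaceOptimalFive/SeparatedCaptureSketch.lean` r4 (sha16 b3584f027d45cbd3, 817 l., farm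
rc 0 / 0 sorry) — proof texts VERBATIM; namespace `…Cruxes.LaplaceOptimalFive.SeparatedCapture` ↦
`…Theorems.RigidityForcesSymmetryRankRigidMinimalRepr.LaplaceFiveSeparatedCapture`; split by the 400-line cap into
`…SeparatedCaptureDefs` (vocabulary + coordinate machinery) → `…SeparatedCapture` (the two forward lemmas) →
`…SeparatedCaptureViolation` (the converse construction + the glue to the Theses decl); DEDUP: the sketch's `weight` is
byte-identical to ✓ `LaplaceFiveSectorSplit.laplaceWeight` and is replaced by it (import, two `unfold`s renamed) — nothing else of
the landed `…LaplaceFive*` files is restated (`Cylindrical` = conjuncts 1–2 of `IsSplitDecomposition`, kept as the sketch's own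
hypothesis shape).

THIS MODULE.  ★ `stub_obligation_captured`: for an exact cylindrical system on a {3,4}-separated pair profile, every obligation tensor
`T_μ = P₅ ⌞ μ` with `μ` annihilating the leaf short factors lies in `L3` of the three triangle short spans (contract the exactness
identity against `μ`: leaf terms drop out, each triangle term contributes `u_t ⊗ (w_t ⌞ μ)`).  ★ `stub_separated_of_capture`:
`CaptureIneq` ⇒ `5! ≤ laplaceWeight T S` for every such system (the symmetric zero-diagonal annihilators of the leaf span form a captured
space of dimension `≥ 10 − n₃₄`; `CaptureIneq` gives `10 − n₃₄ ≤ n₀₁ + n₀₂ + n₁₂`; weight `= 12·|T|`).  Names `stub_*` are the sketch's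
(kept for the card's cross-references); neither carries a `sorry`.

Honest framing.  CONDITIONAL helper rows / an INSTRUMENT for an OPEN crux: `CaptureIneq` itself is OPEN; `LaplaceOptimalFive`
(stmt-ValiantsHypothesis-24813, OPEN · CONTESTED 72/120), `RankRigidMinimalRepr`, `VP ≠ VNP` are NOT proved; no summit statement is
proved by this port.  Credit: statements + proofs val-idea-19 g8 (crux idea #8 `separated-capture`, card
`Cruxes/LaplaceOptimalFive/Ideas/separated-capture.md`, referee val-idea-crit-3 g5); port val-port-4 g3 (desk RULING #358 (A)).
-/

set_option linter.dupNamespace false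

namespace Summit.ValiantsHypothesis.ValiantsHypothesis.Theorems.RigidityForcesSymmetryRankRigidMinimalRepr

namespace LaplaceFiveSeparatedCapture

open Finset LaplaceFiveSectorSplit

/-! ### The first lemma (PROVED): obligations are captured.
Contract the exactness identity against a leaf matrix `μ` annihilating every leaf short factor: the leaf terms drop out,
each triangle term `u_t ⊗ w_t` contributes `u_t ⊗ (w_t ⌞ μ) ∈ U_ab ⊗ V_c`.  (Name kept `stub_…` for the card's cross-references; it carries no
`sorry`.) -/
set_option maxHeartbeats 1600000 in
/-- **Obligations are captured**: for an exact cylindrical system on a {3,4}-separated pair profile, every obligation tensor `T_μ` with `μ` annihilating the leaf short factors lies in `L3` of the triangle short spans (name kept from the sketch; no `sorry`). [folklore] -/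
theorem stub_obligation_captured :
    ∀ (N : ℕ) (T : Finset (Fin N)) (S : Fin N → Finset (Fin 5)) (u w : Fin N → (Fin 5 → Fin 5) → ℂ),
      Cylindrical S u w → (∀ v : Fin 5 → Fin 5, (∑ t ∈ T, u t v * w t v) = perm5 v) → SepProfile34 T S →
      ∀ μ : Fin 5 → Fin 5 → ℂ,
        (∀ t ∈ T, S t = ({3, 4} : Finset (Fin 5)) → (∑ s : Fin 5, ∑ s' : Fin 5, μ s s' * short2 (u t) 3 4 s s') = 0) →
        contractZ μ ∈ L3 (shortSpan T S u 0 1) (shortSpan T S u 0 2) (shortSpan T S u 1 2) := by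
  intro N T S u w hc hex hsep μ hμ
  classical
  -- short factors through `short2` (cylindricity of `u`)
  have hu01 : ∀ t, S t = ({0, 1} : Finset (Fin 5)) → ∀ p q r s t' : Fin 5,
      u t (word p q r s t') = short2 (u t) 0 1 p q := by
    intro t hS p q r s t'
    apply hc.1 t
    intro i hi
    rw [hS] at hi
    simp only [Finset.mem_insert, Finset.mem_singleton] at hi
    rcases hi with rfl | rfl <;> simp [word]
  have hu02 : ∀ t, S t = ({0, 2} : Finset (Fin 5)) → ∀ p q r s t' : Fin 5,
      u t (word p q r s t') = short2 (u t) 0 2 p r := by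
    intro t hS p q r s t'
    apply hc.1 t
    intro i hi
    rw [hS] at hi
    simp only [Finset.mem_insert, Finset.mem_singleton] at hi
    rcases hi with rfl | rfl <;> simp [word]
  have hu12 : ∀ t, S t = ({1, 2} : Finset (Fin 5)) → ∀ p q r s t' : Fin 5,
      u t (word p q r s t') = short2 (u t) 1 2 q r := by
    intro t hS p q r s t'
    apply hc.1 t
    intro i hi
    rw [hS] at hi
    simp only [Finset.mem_insert, Finset.mem_singleton] at hi
    rcases hi with rfl | rfl <;> simp [word]
  have hu34 : ∀ t, S t = ({3, 4} : Finset (Fin 5)) → ∀ p q r s t' : Fin 5,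
      u t (word p q r s t') = short2 (u t) 3 4 s t' := by
    intro t hS p q r s t'
    apply hc.1 t
    intro i hi
    rw [hS] at hi
    simp only [Finset.mem_insert, Finset.mem_singleton] at hi
    rcases hi with rfl | rfl <;> simp [word]
  -- long factors forget the short slots (cylindricity of `w`)
  have hw01 : ∀ t, S t = ({0, 1} : Finset (Fin 5)) → ∀ p q r s t' : Fin 5,
      w t (word p q r s t') = w t (word 0 0 r s t') := by
    intro t hS p q r s t'
    apply hc.2 t
    intro i hi
    rw [hS] at hi
    fin_cases i <;> simp [word] at hi ⊢
  have hw02 : ∀ t, S t = ({0, 2} : Finset (Fin 5)) → ∀ p q r s t' : Fin 5,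
      w t (word p q r s t') = w t (word 0 q 0 s t') := by
    intro t hS p q r s t'
    apply hc.2 t
    intro i hi
    rw [hS] at hi
    fin_cases i <;> simp [word] at hi ⊢
  have hw12 : ∀ t, S t = ({1, 2} : Finset (Fin 5)) → ∀ p q r s t' : Fin 5,
      w t (word p q r s t') = w t (word p 0 0 s t') := by
    intro t hS p q r s t'
    apply hc.2 t
    intro i hi
    rw [hS] at hi
    fin_cases i <;> simp [word] at hi ⊢
  have hw34 : ∀ t, S t = ({3, 4} : Finset (Fin 5)) → ∀ p q r s t' : Fin 5,
      w t (word p q r s t') = w t (word p q r 0 0) := by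
    intro t hS p q r s t'
    apply hc.2 t
    intro i hi
    rw [hS] at hi
    fin_cases i <;> simp [word] at hi ⊢
  -- the obligation tensor is the sum of the per-term contractions
  have key : contractZ μ = ∑ t ∈ T,
      (fun p q r => ∑ s : Fin 5, ∑ t' : Fin 5, μ s t' * (u t (word p q r s t') * w t (word p q r s t'))) := by
    funext p q r
    simp only [Finset.sum_apply, contractZ, ← hex, Finset.mul_sum]
    symm
    rw [Finset.sum_comm]
    refine Finset.sum_congr rfl (fun s _ => ?_)
    rw [Finset.sum_comm]
  rw [key]
  refine Submodule.sum_mem _ (fun t ht => ?_)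
  rcases hsep t ht with h01 | h02 | h12 | h34
  · -- cut 01 | 234 : contributes `short2 (u t) 0 1 ⊗ (w t ⌞ μ)` on slots (0,1) × 2
    have hmem : short2 (u t) 0 1 ∈ shortSpan T S u 0 1 :=
      Submodule.subset_span ⟨t, ⟨ht, h01⟩, rfl⟩
    have hF : (fun p q r => ∑ s : Fin 5, ∑ t' : Fin 5, μ s t' * (u t (word p q r s t') * w t (word p q r s t')))
        = fun p q r => short2 (u t) 0 1 p q * (∑ s : Fin 5, ∑ t' : Fin 5, μ s t' * w t (word 0 0 r s t')) := by
      funext p q r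
      rw [Finset.mul_sum]
      refine Finset.sum_congr rfl (fun s _ => ?_)
      rw [Finset.mul_sum]
      refine Finset.sum_congr rfl (fun t' _ => ?_)
      rw [hu01 t h01 p q r s t', hw01 t h01 p q r s t']
      ring
    rw [hF]
    apply Submodule.subset_span
    simp only [Set.mem_union, Set.mem_setOf_eq]
    exact Or.inl (Or.inl ⟨short2 (u t) 0 1, hmem, _, rfl⟩)
  · -- cut 02 | 134
    have hmem : short2 (u t) 0 2 ∈ shortSpan T S u 0 2 :=
      Submodule.subset_span ⟨t, ⟨ht, h02⟩, rfl⟩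
    have hF : (fun p q r => ∑ s : Fin 5, ∑ t' : Fin 5, μ s t' * (u t (word p q r s t') * w t (word p q r s t')))
        = fun p q r => short2 (u t) 0 2 p r * (∑ s : Fin 5, ∑ t' : Fin 5, μ s t' * w t (word 0 q 0 s t')) := by
      funext p q r
      rw [Finset.mul_sum]
      refine Finset.sum_congr rfl (fun s _ => ?_)
      rw [Finset.mul_sum]
      refine Finset.sum_congr rfl (fun t' _ => ?_)
      rw [hu02 t h02 p q r s t', hw02 t h02 p q r s t']
      ring
    rw [hF]
    apply Submodule.subset_span
    simp only [Set.mem_union, Set.mem_setOf_eq]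
    exact Or.inl (Or.inr ⟨short2 (u t) 0 2, hmem, _, rfl⟩)
  · -- cut 12 | 034
    have hmem : short2 (u t) 1 2 ∈ shortSpan T S u 1 2 :=
      Submodule.subset_span ⟨t, ⟨ht, h12⟩, rfl⟩
    have hF : (fun p q r => ∑ s : Fin 5, ∑ t' : Fin 5, μ s t' * (u t (word p q r s t') * w t (word p q r s t')))
        = fun p q r => short2 (u t) 1 2 q r * (∑ s : Fin 5, ∑ t' : Fin 5, μ s t' * w t (word p 0 0 s t')) := by
      funext p q r
      rw [Finset.mul_sum]
      refine Finset.sum_congr rfl (fun s _ => ?_)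
      rw [Finset.mul_sum]
      refine Finset.sum_congr rfl (fun t' _ => ?_)
      rw [hu12 t h12 p q r s t', hw12 t h12 p q r s t']
      ring
    rw [hF]
    apply Submodule.subset_span
    simp only [Set.mem_union, Set.mem_setOf_eq]
    exact Or.inr ⟨short2 (u t) 1 2, hmem, _, rfl⟩
  · -- leaf cut 34 | 012 : killed by `hμ`
    have hF : (fun p q r => ∑ s : Fin 5, ∑ t' : Fin 5, μ s t' * (u t (word p q r s t') * w t (word p q r s t')))
        = 0 := by
      funext p q r
      simp only [Pi.zero_apply]
      have : ∀ s t' : Fin 5, μ s t' * (u t (word p q r s t') * w t (word p q r s t'))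
          = (μ s t' * short2 (u t) 3 4 s t') * w t (word p q r 0 0) := by
        intro s t'
        rw [hu34 t h34 p q r s t', hw34 t h34 p q r s t']
        ring
      simp only [this, ← Finset.sum_mul, hμ t ht h34, zero_mul]
    rw [hF]
    exact Submodule.zero_mem _

/-! ### The reduction (finite-dimensional duality).  (⟹) `stub_separated_of_capture` is PROVED (rank–nullity on the ℂ¹⁰ chart of `Sym₀`,
`CaptureIneq`, `finrank_span_finset_le_card`, counting); only the converse construction `stub_violation_honest` is open. -/

set_option maxHeartbeats 1600000 in
/-- CAPTURE ⇒ the crux on every {3,4}-separated pair profile (both sectors, any multiplicities, off-shell allowed):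
the symmetric zero-diagonal matrices annihilating the leaf span form a space `W` of dimension `≥ 10 − n₃₄`, all captured
by `stub_obligation_captured`; `CaptureIneq` gives `10 − n₃₄ ≤ m₀₁ + m₀₂ + m₁₂ ≤ n₀₁ + n₀₂ + n₁₂`, and `weight = 12·|T| ≥ 120`. -/
theorem stub_separated_of_capture :
    CaptureIneq →
    ∀ (N : ℕ) (T : Finset (Fin N)) (S : Fin N → Finset (Fin 5)) (u w : Fin N → (Fin 5 → Fin 5) → ℂ),
      Cylindrical S u w → (∀ v : Fin 5 → Fin 5, (∑ t ∈ T, u t v * w t v) = perm5 v) → SepProfile34 T S →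
      Nat.factorial 5 ≤ laplaceWeight T S := by
  intro hcap N T S u w hc hex hsep
  classical
  /- (1) the profile is made of pair cuts: weight = 12·|T| and the four cut classes are disjoint in T -/
  have hweight : laplaceWeight T S = 12 * T.card := by
    unfold laplaceWeight
    rw [Finset.sum_congr rfl (g := fun _ => 12) ?_]
    · simp [mul_comm]
    · intro t ht
      rcases hsep t ht with h | h | h | h <;> rw [h] <;> decide
  have hcount :
      (T.filter (fun t => S t = ({0, 1} : Finset (Fin 5)))).card
        + (T.filter (fun t => S t = ({0, 2} : Finset (Fin 5)))).card
        + (T.filter (fun t => S t = ({1, 2} : Finset (Fin 5)))).card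
        + (T.filter (fun t => S t = ({3, 4} : Finset (Fin 5)))).card ≤ T.card := by
    rw [Finset.card_filter, Finset.card_filter, Finset.card_filter, Finset.card_filter,
      ← Finset.sum_add_distrib, ← Finset.sum_add_distrib, ← Finset.sum_add_distrib, Finset.card_eq_sum_ones T]
    apply Finset.sum_le_sum
    intro t ht
    rcases hsep t ht with h | h | h | h <;> rw [h] <;> decide
  /- (2) spans are at most as big as the number of terms on the cut -/
  have hm : ∀ a b : Fin 5, Module.finrank ℂ (shortSpan T S u a b)
      ≤ (T.filter (fun t => S t = ({a, b} : Finset (Fin 5)))).card := by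
    intro a b
    have hset : ((fun t => short2 (u t) a b) '' {t : Fin N | t ∈ T ∧ S t = ({a, b} : Finset (Fin 5))})
        = (((T.filter (fun t => S t = ({a, b} : Finset (Fin 5)))).image (fun t => short2 (u t) a b) :
            Finset (Fin 5 → Fin 5 → ℂ)) : Set (Fin 5 → Fin 5 → ℂ)) := by
      ext x
      simp
    unfold shortSpan
    rw [hset]
    exact (finrank_span_finset_le_card _).trans Finset.card_image_le
  /- (3) coordinates for the symmetric zero-diagonal leaf matrices: an injective linear chart from ℂ^{10} -/
  let P := {x : Fin 5 × Fin 5 // x.1 < x.2}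
  have hP : Fintype.card P = 10 := by decide
  let LsymFun : (P → ℂ) → (Fin 5 → Fin 5 → ℂ) := fun c s t =>
    if h : s < t then c ⟨(s, t), h⟩ else if h' : t < s then c ⟨(t, s), h'⟩ else 0
  let Lsym : (P → ℂ) →ₗ[ℂ] (Fin 5 → Fin 5 → ℂ) :=
    { toFun := LsymFun
      map_add' := by
        intro c c'
        funext s t
        simp only [LsymFun, Pi.add_apply]
        split_ifs <;> simp
      map_smul' := by
        intro r c
        funext s t
        simp only [LsymFun, Pi.smul_apply, smul_eq_mul, RingHom.id_apply]
        split_ifs <;> simp }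
  have hLsym_apply : ∀ c s t, Lsym c s t = LsymFun c s t := fun _ _ _ => rfl
  have hinj : Function.Injective Lsym := by
    intro c c' h
    funext π
    have := congr_fun (congr_fun h π.1.1) π.1.2
    simpa [hLsym_apply, LsymFun, π.2] using this
  have hsym : ∀ c (s t : Fin 5), Lsym c s t = Lsym c t s := by
    intro c s t
    simp only [hLsym_apply, LsymFun]
    rcases lt_trichotomy s t with h | rfl | h
    · simp [h, not_lt.mpr h.le]
    · simp
    · simp [h, not_lt.mpr h.le]
  have hdiag : ∀ c (s : Fin 5), Lsym c s s = 0 := by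
    intro c s
    simp [hLsym_apply, LsymFun]
  /- (4) the leaf evaluation map and its kernel (rank–nullity: dim ker ≥ 10 − n₃₄) -/
  let ev : (Fin 5 → Fin 5 → ℂ) →ₗ[ℂ] ((T.filter (fun t => S t = ({3, 4} : Finset (Fin 5)))) → ℂ) :=
    { toFun := fun M t => ∑ s : Fin 5, ∑ s' : Fin 5, M s s' * short2 (u t.1) 3 4 s s'
      map_add' := by
        intro M M'
        funext t
        simp only [Pi.add_apply, add_mul, Finset.sum_add_distrib]
      map_smul' := by
        intro r M
        funext t
        simp only [Pi.smul_apply, smul_eq_mul, RingHom.id_apply, Finset.mul_sum, mul_assoc] }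
  have hev_apply : ∀ M t, ev M t = ∑ s : Fin 5, ∑ s' : Fin 5, M s s' * short2 (u t.1) 3 4 s s' :=
    fun _ _ => rfl
  let ev' : (P → ℂ) →ₗ[ℂ] ((T.filter (fun t => S t = ({3, 4} : Finset (Fin 5)))) → ℂ) := ev ∘ₗ Lsym
  have hrn := LinearMap.finrank_range_add_finrank_ker ev'
  rw [Module.finrank_fintype_fun_eq_card, hP] at hrn
  have hrange : Module.finrank ℂ (LinearMap.range ev')
      ≤ (T.filter (fun t => S t = ({3, 4} : Finset (Fin 5)))).card := by
    have := Submodule.finrank_le (LinearMap.range ev')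
    rwa [Module.finrank_fintype_fun_eq_card, Fintype.card_coe] at this
  /- (5) the captured space W := Lsym (ker ev') and the capture inequality -/
  have hWK : Module.finrank ℂ ((LinearMap.ker ev').map Lsym) = Module.finrank ℂ (LinearMap.ker ev') :=
    (LinearEquiv.finrank_eq (Submodule.equivMapOfInjective Lsym hinj (LinearMap.ker ev'))).symm
  have hcapW : Module.finrank ℂ ((LinearMap.ker ev').map Lsym)
      ≤ Module.finrank ℂ (shortSpan T S u 0 1) + Module.finrank ℂ (shortSpan T S u 0 2)
        + Module.finrank ℂ (shortSpan T S u 1 2) := by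
    apply hcap
    · intro μ hμ s t
      obtain ⟨c, -, rfl⟩ := Submodule.mem_map.1 hμ
      exact hsym c s t
    · intro μ hμ s
      obtain ⟨c, -, rfl⟩ := Submodule.mem_map.1 hμ
      exact hdiag c s
    · intro μ hμ
      obtain ⟨c, hcK, rfl⟩ := Submodule.mem_map.1 hμ
      apply stub_obligation_captured N T S u w hc hex hsep
      intro t ht h34
      have h0 := congr_fun (LinearMap.mem_ker.1 hcK) ⟨t, Finset.mem_filter.2 ⟨ht, h34⟩⟩
      rw [Pi.zero_apply] at h0
      simpa [ev', hev_apply] using h0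
  /- (6) count -/
  have h01 := hm 0 1
  have h02 := hm 0 2
  have h12 := hm 1 2
  have h5 : Nat.factorial 5 = 120 := by decide
  rw [h5, hweight]
  omega

end LaplaceFiveSeparatedCapture

end Summit.ValiantsHypothesis.ValiantsHypothesis.Theorems.RigidityForcesSymmetryRankRigidMinimalRepr
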